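import Literature.NumberTheory.Automorphic.BrandtHeckeProjector
import Literature.NumberTheory.Automorphic.BrandtMultiplicativityHolds
import Literature.RingTheory.CompleteIntersection.CongruenceModule
import Mathlib.RingTheory.Noetherian.Basic
import HarnessLib

/-!
# The anemic integral Brandt–Hecke algebra of a setup and the eigen-augmentation of an eigen-line

Requested by the crux lines of route `ABC/DefiniteXi` (items stmt-ABC-15023 `EisensteinQuarantine`,
stmt-ABC-11336 `XiBound`): the RING-side objects whose congruence ideal the lattice congruence number
`ξ` of Pollack–Weston divides (`BrandtLatticeRingCongruence.lean`), packaged so that the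
congruence-module / cotangent-module machinery of
`Literature.RingTheory.CompleteIntersection` (de Smit–Rubin–Schoof, Lenstra) applies to them.

Let `S` be a Brandt setup of type `(N⁺, N⁻)` (`Brandt.XiSetup`: a definite quaternion algebra over
`ℚ` of discriminant `N⁻` with an Eichler order `O` of level `N⁺`), `B(n) = Brandt.matrix S.O n` its
Brandt matrices on the finite class set `Cls O`.

* `Brandt.XiSetup.heckeAlgebra S` — **the anemic integral Hecke algebra**
  `𝕋⁰(S) = ℤ[B(p) : p prime, p ∤ N⁺N⁻] ⊆ M_{Cls O}(ℤ)` (Mathlib `Algebra.adjoin`), the integral form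
  of Pollack–Weston's `𝕋₀(N⁺, N⁻)` (Compos. Math. 147 (2011), §2.1–2.2, there `p`-adically completed
  and with the `U_q`; Darmon–Diamond–Taylor §4.1 for the anemic variant `𝕋^{(D)}`).  It is a
  **commutative ring** (`heckeAlgebra.instCommRing`, from the tree's
  `Brandt.XiSetup.matrix_comm_of_coprime`, Eichler/Vignéras) and a Noetherian ring
  (`heckeAlgebra.instIsNoetherianRing`: a subring of `M_h(ℤ)`).
* `Brandt.XiSetup.eigenAugmentation S λ hφ hL : 𝕋⁰(S) →ₐ[ℤ] ℤ` — **the eigencharacter `π_φ` of an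
  eigen-line**: if the eigen-lattice of `λ` (`Brandt.eigenLattice`, primes `p ∤ N⁺N⁻`) is the line
  `ℤ φ`, `φ ≠ 0`, every `x ∈ 𝕋⁰(S)` acts on `φ` by an integer `π_φ(x)` (`eigenAugmentation_spec`:
  `x φ = π_φ(x) φ`), with `π_φ(B(p)) = λ(p)` (`eigenAugmentation_matrix`).  This is Pollack–Weston's
  `π_f : 𝕋₀ → 𝒪`, `T_ℓ ↦ a_ℓ` (§2.2) over `ℤ`.
* `ker_eigenAugmentation_eq_span` — `ker π_φ` is generated by the `B(p) − λ(p)`, `p ∤ N⁺N⁻`;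
  `mem_annihilator_ker_iff` — `x ∈ Ann_{𝕋⁰}(ker π_φ)` iff `x · (B(p) − λ(p)) = 0` for all such `p`
  (the hypothesis of `Brandt.XiSetup.xi_dvd_twelve_mul_of_mul_sub_eq_zero`);
  `fg_ker_eigenAugmentation` — `ker π_φ` is finitely generated (input of Lenstra's
  `Fit₀(I/I²) ⊆ η`, `Literature.RingTheory.CompleteIntersection.fittingIdeal_cotangentModule_le_congruenceIdeal`).
  The congruence ideal of `π_φ` is then
  `Literature.RingTheory.CompleteIntersection.congruenceIdeal (S.eigenAugmentation λ hφ hL)`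
  (no new name is introduced for it).

Design.  `heckeAlgebra` is a `Subalgebra ℤ (Matrix _ _ ℤ)` (the `DecidableEq` instance on the
class set is the classical one, as in `BrandtHeckeProjector.lean`); the commutative-ring structure is
Mathlib's `Algebra.isMulCommutative_adjoin` together with the (scoped) `IsMulCommutative` ⇒
`CommRing` instance, registered here for this type; its underlying `Ring` is the subalgebra's, so no
instance diamond arises.  The augmentation is first built as a ring homomorphism from the
eigenvalue function (`Classical.choose` of `x φ ∈ ℤ φ`, unique since `φ ≠ 0`) and then promoted by
`RingHom.toIntAlgHom`.

What is NOT here: the full algebra with `U_q`, `W_q` (`ℤ[B(n) : n ≥ 1]`, whose commutativity at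
`q² ∣ N⁺` the tree does not have), base change to `ℤ_p` / localisation at a maximal ideal
(`Literature.NumberTheory.Automorphic.HeckeCongruenceIdealLocal` pattern), multiplicity one /
Gorenstein / freeness of the Brandt module over `𝕋⁰` (Emerton 2002; false in general at Eisenstein
`p = 2`, Calegari–Emerton 2005), and any bound on the congruence ideal.  Mathlib searches: no
`Brandt`, no Hecke algebra of a quaternion order; used `Algebra.adjoin`,
`Algebra.isMulCommutative_adjoin`, `Algebra.commute_of_mem_adjoin_of_forall_mem_commute`,
`RingHom.toIntAlgHom`, `Submodule.mem_annihilator_span`, `isNoetherian_of_tower`.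

## References

* R. Pollack, T. Weston, *On anticyclotomic μ-invariants of modular forms*, Compos. Math. 147
  (2011), §2.1–2.2 [PollackWeston2011].
* H. Darmon, F. Diamond, R. Taylor, *Fermat's Last Theorem*, Current Developments in Math. 1995,
  §4.1 [DarmonDiamondTaylor1995].
* F. Diamond, *The Taylor–Wiles construction and multiplicity one*, Invent. Math. 128 (1997)
  [Diamond1997].
* F. Calegari, M. Emerton, *On the ramification of Hecke algebras at Eisenstein primes*,
  Invent. Math. 160 (2005) [CalegariEmerton2005].
-/

noncomputable section

open scoped Matrix

namespace Literature.NumberTheory.Automorphic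

namespace Brandt

namespace XiSetup

variable {Nplus Nminus : ℕ} (S : XiSetup Nplus Nminus) [Fintype (ClassSet S.O)]

/-! ### The anemic Hecke algebra `𝕋⁰(S)` -/

open scoped Classical in
/-- **The anemic integral Brandt–Hecke algebra** `𝕋⁰(S) = ℤ[B(p) : p prime, p ∤ N⁺N⁻]` of a Brandt
setup `S` of type `(N⁺, N⁻)`: the `ℤ`-subalgebra of `M_{Cls O}(ℤ)` generated by the Brandt matrices
at the primes not dividing the level (Pollack–Weston 2011 §2.1, `𝕋₀(N⁺,N⁻)`, integral and anemic
form; Darmon–Diamond–Taylor §4.1). [cite: PollackWeston2011, §2.1] -/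
def heckeAlgebra : Subalgebra ℤ (Matrix (ClassSet S.O) (ClassSet S.O) ℤ) :=
  Algebra.adjoin ℤ {X | ∃ p : ℕ, p.Prime ∧ ¬ p ∣ Nplus * Nminus ∧ X = Brandt.matrix S.O p}

open scoped Classical in
/-- Unfolding lemma for `heckeAlgebra`. [folklore] -/
theorem heckeAlgebra_def : S.heckeAlgebra =
    Algebra.adjoin ℤ {X | ∃ p : ℕ, p.Prime ∧ ¬ p ∣ Nplus * Nminus ∧ X = Brandt.matrix S.O p} :=
  rfl

open scoped Classical in
/-- The Brandt matrices `B(p)`, `p` prime, `p ∤ N⁺N⁻`, lie in `𝕋⁰(S)`. [folklore] -/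
theorem matrix_mem_heckeAlgebra {p : ℕ} (hp : p.Prime) (hpN : ¬ p ∣ Nplus * Nminus) :
    Brandt.matrix S.O p ∈ S.heckeAlgebra :=
  Algebra.subset_adjoin ⟨p, hp, hpN, rfl⟩

/-- Brandt matrices at primes commute (`B(p) B(q) = B(q) B(p)`; distinct primes are coprime,
`Brandt.XiSetup.matrix_comm_of_coprime`). [folklore] -/
theorem matrix_comm_of_prime {p q : ℕ} (hp : p.Prime) (hq : q.Prime) :
    Brandt.matrix S.O p * Brandt.matrix S.O q = Brandt.matrix S.O q * Brandt.matrix S.O p := by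
  by_cases hpq : p = q
  · rw [hpq]
  · exact S.matrix_comm_of_coprime ((Nat.coprime_primes hp hq).mpr hpq)

open scoped Classical in
/-- The multiplication of `𝕋⁰(S)` is commutative (generated by pairwise commuting matrices;
Mathlib's `Algebra.isMulCommutative_adjoin`). [folklore] -/
instance heckeAlgebra.instIsMulCommutative {S : XiSetup Nplus Nminus} [Fintype (ClassSet S.O)] :
    IsMulCommutative S.heckeAlgebra :=
  Algebra.isMulCommutative_adjoin ℤ (by
    rintro _ ⟨p, hp, -, rfl⟩ _ ⟨q, hq, -, rfl⟩
    exact S.matrix_comm_of_prime hp hq)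

open scoped Classical IsMulCommutative in
/-- **`𝕋⁰(S)` is a commutative ring**: the subalgebra's ring structure with the commutativity of
`heckeAlgebra.instIsMulCommutative` (Mathlib's scoped `IsMulCommutative` instance, registered
globally for this type so that `congruenceIdeal` and friends apply). [folklore] -/
instance heckeAlgebra.instCommRing {S : XiSetup Nplus Nminus} [Fintype (ClassSet S.O)] :
    CommRing S.heckeAlgebra :=
  inferInstance

open scoped Classical in
/-- `𝕋⁰(S)` is module-finite over `ℤ` (a submodule of the finite free `ℤ`-module `M_h(ℤ)`). [folklore] -/
instance heckeAlgebra.instModuleFinite {S : XiSetup Nplus Nminus} [Fintype (ClassSet S.O)] :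
    Module.Finite ℤ S.heckeAlgebra :=
  Module.Finite.of_injective S.heckeAlgebra.val.toLinearMap Subtype.val_injective

open scoped Classical in
/-- **`𝕋⁰(S)` is a Noetherian ring** (Noetherian as a `ℤ`-module, hence over itself). [folklore] -/
instance heckeAlgebra.instIsNoetherianRing {S : XiSetup Nplus Nminus} [Fintype (ClassSet S.O)] :
    IsNoetherianRing S.heckeAlgebra :=
  isNoetherian_of_tower ℤ (inferInstance : IsNoetherian ℤ S.heckeAlgebra)

open scoped Classical in
/-- Each generator `B(p)` commutes with every element of `𝕋⁰(S)`. [folklore] -/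
theorem commute_matrix_of_mem_heckeAlgebra {x : Matrix (ClassSet S.O) (ClassSet S.O) ℤ}
    (hx : x ∈ S.heckeAlgebra) {p : ℕ} (hp : p.Prime) :
    Commute (Brandt.matrix S.O p) x :=
  Algebra.commute_of_mem_adjoin_of_forall_mem_commute hx fun X hX => by
    obtain ⟨q, hq, -, rfl⟩ := hX
    exact S.matrix_comm_of_prime hp hq

open scoped Classical in
/-- **`𝕋⁰(S)` preserves the eigen-lattice**: for `x ∈ 𝕋⁰(S)` and `v ∈ L(λ)`,
`B(p) (x v) = x (B(p) v) = λ(p) x v`. [folklore] -/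
theorem mulVec_mem_eigenLattice (lam : ℕ → ℤ) {x : Matrix (ClassSet S.O) (ClassSet S.O) ℤ}
    (hx : x ∈ S.heckeAlgebra) {v : ClassSet S.O → ℤ}
    (hv : v ∈ eigenLattice (Nplus * Nminus) (Brandt.matrix S.O) lam) :
    x *ᵥ v ∈ eigenLattice (Nplus * Nminus) (Brandt.matrix S.O) lam := by
  intro p hp hpN
  rw [Matrix.mulVec_mulVec, (S.commute_matrix_of_mem_heckeAlgebra hx hp).eq,
    ← Matrix.mulVec_mulVec, hv p hp hpN, Matrix.mulVec_smul]

/-! ### The eigen-augmentation of an eigen-line -/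

section Line

variable (lam : ℕ → ℤ) {φ : ClassSet S.O → ℤ}

open scoped Classical in
/-- On an eigen-line `L(λ) = ℤ φ`, every `x ∈ 𝕋⁰(S)` acts on `φ` by an integer. [folklore] -/
theorem exists_mulVec_eq_smul (hL : eigenLattice (Nplus * Nminus) (Brandt.matrix S.O) lam = ℤ ∙ φ)
    (x : S.heckeAlgebra) :
    ∃ c : ℤ, (x : Matrix (ClassSet S.O) (ClassSet S.O) ℤ) *ᵥ φ = c • φ := by
  have h : (x : Matrix (ClassSet S.O) (ClassSet S.O) ℤ) *ᵥ φ ∈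
      eigenLattice (Nplus * Nminus) (Brandt.matrix S.O) lam :=
    S.mulVec_mem_eigenLattice lam x.2 (by rw [hL]; exact Submodule.mem_span_singleton_self φ)
  rw [hL] at h
  obtain ⟨c, hc⟩ := Submodule.mem_span_singleton.mp h
  exact ⟨c, hc.symm⟩

omit [Fintype (ClassSet S.O)] in
/-- The integer by which a matrix acts on a non-zero vector is unique. [folklore] -/
theorem smul_line_injective (hφ : φ ≠ 0) {c c' : ℤ} (h : c • φ = c' • φ) : c = c' :=
  smul_left_injective ℤ hφ h

open scoped Classical in
/-- The eigenvalue of `x ∈ 𝕋⁰(S)` on the generator `φ` of the eigen-line, as a bare function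
(auxiliary; use `eigenAugmentation`). [folklore] -/
def eigenvalueOf (hL : eigenLattice (Nplus * Nminus) (Brandt.matrix S.O) lam = ℤ ∙ φ) (x : S.heckeAlgebra) : ℤ :=
  (S.exists_mulVec_eq_smul lam hL x).choose

open scoped Classical in
/-- Defining property of `eigenvalueOf`: `x φ = eigenvalueOf x • φ`. [folklore] -/
theorem mulVec_eq_eigenvalueOf_smul (hL : eigenLattice (Nplus * Nminus) (Brandt.matrix S.O) lam = ℤ ∙ φ) (x : S.heckeAlgebra) :
    (x : Matrix (ClassSet S.O) (ClassSet S.O) ℤ) *ᵥ φ = S.eigenvalueOf lam hL x • φ :=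
  (S.exists_mulVec_eq_smul lam hL x).choose_spec

open scoped Classical in
/-- `eigenvalueOf` is characterised by `x φ = c φ`. [folklore] -/
theorem eigenvalueOf_eq_of_mulVec_eq_smul (hφ : φ ≠ 0)
    (hL : eigenLattice (Nplus * Nminus) (Brandt.matrix S.O) lam = ℤ ∙ φ)
    {x : S.heckeAlgebra} {c : ℤ}
    (h : (x : Matrix (ClassSet S.O) (ClassSet S.O) ℤ) *ᵥ φ = c • φ) :
    S.eigenvalueOf lam hL x = c :=
  S.smul_line_injective hφ ((S.mulVec_eq_eigenvalueOf_smul lam hL x).symm.trans h)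

open scoped Classical in
/-- **The eigen-augmentation `π_φ : 𝕋⁰(S) →ₐ[ℤ] ℤ` of the eigen-line `ℤ φ`** (Pollack–Weston 2011
§2.2, `π_f : 𝕋₀ → 𝒪`, `T_ℓ ↦ a_ℓ(f)`, in integral anemic form): `x ↦` the integer by which `x`
acts on `φ`.  A ring homomorphism because `(xy) φ = x (π(y) φ) = π(y) π(x) φ`; `ℤ`-linear
automatically (`RingHom.toIntAlgHom`). [cite: PollackWeston2011, §2.2] -/
def eigenAugmentation (hφ : φ ≠ 0)
    (hL : eigenLattice (Nplus * Nminus) (Brandt.matrix S.O) lam = ℤ ∙ φ) :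
    S.heckeAlgebra →ₐ[ℤ] ℤ :=
  RingHom.toIntAlgHom
    { toFun := S.eigenvalueOf lam hL
      map_one' := S.eigenvalueOf_eq_of_mulVec_eq_smul lam hφ hL (by
        rw [OneMemClass.coe_one, Matrix.one_mulVec, one_smul])
      map_mul' := fun x y => S.eigenvalueOf_eq_of_mulVec_eq_smul lam hφ hL (by
        rw [MulMemClass.coe_mul, ← Matrix.mulVec_mulVec, S.mulVec_eq_eigenvalueOf_smul lam hL y,
          Matrix.mulVec_smul, S.mulVec_eq_eigenvalueOf_smul lam hL x, smul_smul, mul_comm])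
      map_zero' := S.eigenvalueOf_eq_of_mulVec_eq_smul lam hφ hL (by
        rw [ZeroMemClass.coe_zero, Matrix.zero_mulVec, zero_smul])
      map_add' := fun x y => S.eigenvalueOf_eq_of_mulVec_eq_smul lam hφ hL (by
        rw [AddMemClass.coe_add, Matrix.add_mulVec, S.mulVec_eq_eigenvalueOf_smul lam hL x,
          S.mulVec_eq_eigenvalueOf_smul lam hL y, add_smul]) }

open scoped Classical in
/-- **Defining property of the eigen-augmentation**: `x φ = π_φ(x) φ` for every `x ∈ 𝕋⁰(S)`. [folklore] -/
theorem eigenAugmentation_spec (hφ : φ ≠ 0)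
    (hL : eigenLattice (Nplus * Nminus) (Brandt.matrix S.O) lam = ℤ ∙ φ) (x : S.heckeAlgebra) :
    (x : Matrix (ClassSet S.O) (ClassSet S.O) ℤ) *ᵥ φ = S.eigenAugmentation lam hφ hL x • φ :=
  S.mulVec_eq_eigenvalueOf_smul lam hL x

open scoped Classical in
/-- The eigen-augmentation is characterised by `x φ = c φ`. [folklore] -/
theorem eigenAugmentation_eq_of_mulVec_eq_smul (hφ : φ ≠ 0)
    (hL : eigenLattice (Nplus * Nminus) (Brandt.matrix S.O) lam = ℤ ∙ φ)
    {x : S.heckeAlgebra} {c : ℤ}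
    (h : (x : Matrix (ClassSet S.O) (ClassSet S.O) ℤ) *ᵥ φ = c • φ) :
    S.eigenAugmentation lam hφ hL x = c :=
  S.eigenvalueOf_eq_of_mulVec_eq_smul lam hφ hL h

open scoped Classical in
/-- **`π_φ(B(p)) = λ(p)`** for the primes `p ∤ N⁺N⁻` (`φ ∈ L(λ)`). [folklore] -/
theorem eigenAugmentation_matrix (hφ : φ ≠ 0)
    (hL : eigenLattice (Nplus * Nminus) (Brandt.matrix S.O) lam = ℤ ∙ φ)
    {p : ℕ} (hp : p.Prime) (hpN : ¬ p ∣ Nplus * Nminus) :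
    S.eigenAugmentation lam hφ hL ⟨Brandt.matrix S.O p, S.matrix_mem_heckeAlgebra hp hpN⟩ = lam p := by
  refine S.eigenAugmentation_eq_of_mulVec_eq_smul lam hφ hL ?_
  have hφL : φ ∈ eigenLattice (Nplus * Nminus) (Brandt.matrix S.O) lam := by
    rw [hL]; exact Submodule.mem_span_singleton_self φ
  exact hφL p hp hpN

open scoped Classical in
/-- The generator `B(p) − λ(p)` of the augmentation ideal, as an element of `𝕋⁰(S)`. [folklore] -/
theorem matrix_sub_algebraMap_mem_ker (hφ : φ ≠ 0)
    (hL : eigenLattice (Nplus * Nminus) (Brandt.matrix S.O) lam = ℤ ∙ φ)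
    {p : ℕ} (hp : p.Prime) (hpN : ¬ p ∣ Nplus * Nminus) :
    (⟨Brandt.matrix S.O p, S.matrix_mem_heckeAlgebra hp hpN⟩ - algebraMap ℤ S.heckeAlgebra (lam p) :
      S.heckeAlgebra) ∈ RingHom.ker (S.eigenAugmentation lam hφ hL) := by
  rw [RingHom.mem_ker, map_sub, S.eigenAugmentation_matrix lam hφ hL hp hpN, AlgHom.commutes,
    Algebra.algebraMap_self, RingHom.id_apply, sub_self]

open scoped Classical in
/-- Every `x ∈ 𝕋⁰(S)` is congruent to the scalar `π_φ(x)` modulo the ideal generated by the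
`B(p) − λ(p)`, `p ∤ N⁺N⁻` (induction over the generators; for a product,
`xy − π(xy) = x (y − π(y)) + π(y) (x − π(x))`). [folklore] -/
theorem sub_algebraMap_mem_span (hφ : φ ≠ 0)
    (hL : eigenLattice (Nplus * Nminus) (Brandt.matrix S.O) lam = ℤ ∙ φ) (x : S.heckeAlgebra) :
    x - algebraMap ℤ S.heckeAlgebra (S.eigenAugmentation lam hφ hL x) ∈
      Ideal.span {t : S.heckeAlgebra | ∃ (p : ℕ) (hp : p.Prime) (hpN : ¬ p ∣ Nplus * Nminus),
        t = ⟨Brandt.matrix S.O p, S.matrix_mem_heckeAlgebra hp hpN⟩ -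
          algebraMap ℤ S.heckeAlgebra (lam p)} := by
  set J := Ideal.span {t : S.heckeAlgebra | ∃ (p : ℕ) (hp : p.Prime) (hpN : ¬ p ∣ Nplus * Nminus),
        t = ⟨Brandt.matrix S.O p, S.matrix_mem_heckeAlgebra hp hpN⟩ -
          algebraMap ℤ S.heckeAlgebra (lam p)} with hJ
  obtain ⟨X, hX⟩ := x
  induction hX using Algebra.adjoin_induction with
  | mem X hX' =>
    obtain ⟨p, hp, hpN, rfl⟩ := hX'
    rw [S.eigenAugmentation_matrix lam hφ hL hp hpN]
    exact Ideal.subset_span ⟨p, hp, hpN, rfl⟩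
  | algebraMap r =>
    have h : (⟨algebraMap ℤ (Matrix (ClassSet S.O) (ClassSet S.O) ℤ) r, Subalgebra.algebraMap_mem _ r⟩ :
        S.heckeAlgebra) = algebraMap ℤ S.heckeAlgebra r := rfl
    rw [h, AlgHom.commutes, Algebra.algebraMap_self, RingHom.id_apply, sub_self]
    exact J.zero_mem
  | add X Y hX' hY' hx hy =>
    have h : (⟨X + Y, add_mem hX' hY'⟩ : S.heckeAlgebra) = ⟨X, hX'⟩ + ⟨Y, hY'⟩ := rfl
    rw [h, map_add, map_add, add_sub_add_comm]
    exact J.add_mem hx hy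
  | mul X Y hX' hY' hx hy =>
    have h : (⟨X * Y, mul_mem hX' hY'⟩ : S.heckeAlgebra) = ⟨X, hX'⟩ * ⟨Y, hY'⟩ := rfl
    rw [h, map_mul, map_mul]
    set a : S.heckeAlgebra := ⟨X, hX'⟩
    set b : S.heckeAlgebra := ⟨Y, hY'⟩
    set πa := S.eigenAugmentation lam hφ hL a
    set πb := S.eigenAugmentation lam hφ hL b
    have e : a * b - algebraMap ℤ S.heckeAlgebra πa * algebraMap ℤ S.heckeAlgebra πb =
        a * (b - algebraMap ℤ S.heckeAlgebra πb) +
          algebraMap ℤ S.heckeAlgebra πb * (a - algebraMap ℤ S.heckeAlgebra πa) := by ring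
    rw [e]
    exact J.add_mem (J.mul_mem_left _ hy) (J.mul_mem_left _ hx)

open scoped Classical in
/-- **The augmentation ideal `ker π_φ` is generated by the `B(p) − λ(p)`, `p` prime, `p ∤ N⁺N⁻`**
(Diamond–Ribet §4.3: congruences of eigenforms are congruences of the eigenvalues `a_p`). [folklore] -/
theorem ker_eigenAugmentation_eq_span (hφ : φ ≠ 0)
    (hL : eigenLattice (Nplus * Nminus) (Brandt.matrix S.O) lam = ℤ ∙ φ) :
    RingHom.ker (S.eigenAugmentation lam hφ hL) =
      Ideal.span {t : S.heckeAlgebra | ∃ (p : ℕ) (hp : p.Prime) (hpN : ¬ p ∣ Nplus * Nminus),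
        t = ⟨Brandt.matrix S.O p, S.matrix_mem_heckeAlgebra hp hpN⟩ -
          algebraMap ℤ S.heckeAlgebra (lam p)} := by
  refine le_antisymm (fun x hx => ?_) (Ideal.span_le.mpr ?_)
  · have h := S.sub_algebraMap_mem_span lam hφ hL x
    rwa [RingHom.mem_ker.mp hx, map_zero, sub_zero] at h
  · rintro _ ⟨p, hp, hpN, rfl⟩
    exact S.matrix_sub_algebraMap_mem_ker lam hφ hL hp hpN

open scoped Classical in
/-- **`Ann_{𝕋⁰}(ker π_φ)` in matrix terms**: `x ∈ 𝕋⁰(S)` annihilates the augmentation ideal iff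
`x · (B(p) − λ(p)) = 0` for all primes `p ∤ N⁺N⁻` — the hypothesis under which
`BrandtLatticeRingCongruence.lean` proves `ξ ∣ 12 · π_φ(x)`. [folklore] -/
theorem mem_annihilator_ker_iff (hφ : φ ≠ 0)
    (hL : eigenLattice (Nplus * Nminus) (Brandt.matrix S.O) lam = ℤ ∙ φ) {x : S.heckeAlgebra} :
    x ∈ (RingHom.ker (S.eigenAugmentation lam hφ hL)).annihilator ↔
      ∀ p : ℕ, p.Prime → ¬ p ∣ Nplus * Nminus →
        (x : Matrix (ClassSet S.O) (ClassSet S.O) ℤ) *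
          (Brandt.matrix S.O p - lam p • (1 : Matrix (ClassSet S.O) (ClassSet S.O) ℤ)) = 0 := by
  rw [S.ker_eigenAugmentation_eq_span lam hφ hL, Submodule.mem_annihilator_span]
  have hcoe : ∀ (p : ℕ) (hp : p.Prime) (hpN : ¬ p ∣ Nplus * Nminus),
      ((⟨Brandt.matrix S.O p, S.matrix_mem_heckeAlgebra hp hpN⟩ -
          algebraMap ℤ S.heckeAlgebra (lam p) : S.heckeAlgebra) :
        Matrix (ClassSet S.O) (ClassSet S.O) ℤ) =
        Brandt.matrix S.O p - lam p • (1 : Matrix (ClassSet S.O) (ClassSet S.O) ℤ) := by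
    intro p hp hpN
    rw [AddSubgroupClass.coe_sub, Subalgebra.coe_algebraMap, Algebra.algebraMap_eq_smul_one]
  constructor
  · intro h p hp hpN
    have h1 := h ⟨_, p, hp, hpN, rfl⟩
    rw [smul_eq_mul, Subtype.ext_iff, MulMemClass.coe_mul, ZeroMemClass.coe_zero, hcoe p hp hpN] at h1
    exact h1
  · rintro h ⟨_, p, hp, hpN, rfl⟩
    rw [smul_eq_mul, Subtype.ext_iff, MulMemClass.coe_mul, ZeroMemClass.coe_zero, hcoe p hp hpN]
    exact h p hp hpN

open scoped Classical in
/-- The augmentation ideal `ker π_φ` is finitely generated (`𝕋⁰(S)` is Noetherian) — the finiteness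
input of Lenstra's `Fit₀(ker/ker²) ⊆ η`. [folklore] -/
theorem fg_ker_eigenAugmentation (hφ : φ ≠ 0)
    (hL : eigenLattice (Nplus * Nminus) (Brandt.matrix S.O) lam = ℤ ∙ φ) :
    (RingHom.ker (S.eigenAugmentation lam hφ hL)).FG :=
  IsNoetherian.noetherian _

open scoped Classical in
/-- The eigen-augmentation is surjective (an augmentation). [folklore] -/
theorem eigenAugmentation_surjective (hφ : φ ≠ 0)
    (hL : eigenLattice (Nplus * Nminus) (Brandt.matrix S.O) lam = ℤ ∙ φ) :
    Function.Surjective (S.eigenAugmentation lam hφ hL) :=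
  Literature.RingTheory.CompleteIntersection.augmentation_surjective _

end Line

end XiSetup

end Brandt

end Literature.NumberTheory.Automorphic

end
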